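/-
Copyright: statement-level skeleton of a published paper (lit-balaban cell, Phase-2 proof seat p20 gen 7). No proof claims
beyond what the kernel checks below.
-/
import Literature.MathematicalPhysics.QuantumFieldTheory.Balaban1983to89.B3CxiSecondDifferenceBound
import Literature.MathematicalPhysics.QuantumFieldTheory.Balaban1983to89.B3CxiTadpole

/-!
# B3 — T. Bałaban, *(Higgs)₂,₃ quantum fields in a finite volume. III. Renormalization*, CMP **88** (1983) 411–445
[Balaban1983Higgs3], (2.10) p. 426 / p. 437: the free propagator C^ξ on ξℤ³ and its first and second differences AT ALL SITES
(y = 0 included) in the regularised-distance profile B·(ξ·max(1,|y|_∞))^{−1−k}e^{−½ξ|y|_∞}, k = 0, 1, 2, uniformly in 0 < ξ ≤ 1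

statement-level skeleton of published theorems with citation tags; proofs where landed; nothing here is a claim about
the Yang–Mills mass gap

PDF held: `paper:balaban1983-higgs-2-3-quantum-fields-finite-volume` (journal page = PDF page + 410), p. 426 [PDF 16], p. 437 [PDF 27].
WHAT IS REPRODUCED: a member of rows **B3.Eq2.10** / **B3.Eq3.11-3.17** of `HOME/lit-balaban-r15/ROWS-B3.md` (fold owner r15): the
(2.10)-type bounds *"|G(x,x′)| ≤ O(1)(L^jη)^{−1}d(x,x′)^{−1}e^{−δ₀d(x,x′)} … for each differentiation ∂^η … an additional factor
(L^jη)^{−1}d(x,x′)^{−1}"* and the p. 437 sentence *"|C^ξ(y − y′)| ≦ O(1)e^{−½|y−y′|}/|y − y′| … and the corresponding inequalities for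
derivatives"* for the free propagator of the ξ-lattice (r15's `B3Sect3VectorSelfEnergy.Cxi 3 ξ`), collected AT ALL SITES with the
regularised distance d = ξ·max(1,|y|_∞) of (1.3)/(2.10) (on the lattice the propagator and its differences are finite at y = 0), the
shape in which the (3.16)/(3.26) lattice-sum estimates consume kernels (seat p39's `B3ZeroTorusKernelProfiles`, `B3KernelConvolutionTorus`):
for 0 < ξ ≤ 1, ALL y ∈ ℤ³, all directions and unit steps of either sign,
* `Cxi_le_all`: 0 ≤ C^ξ(y) ≤ 140·ξ^{−1};  `abs_Cxi_profile_sup`: |C^ξ(y)| ≤ 140·(ξ·max(1,|y|_∞))^{−1}·e^{−ξ|y|_∞/2} (p39's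
  `B3CxiUniformBound.Cxi_three_le_sup` off the origin, seat p20 g4's tadpole bound `B3CxiTadpole.Cxi_zero_le_three` at it);
* `abs_Cxi_fwdDiff_profile_sup` / `abs_Cxi_bwdDiff_profile_sup` / `abs_Cxi_stepDiff_profile_sup`:
  |C^ξ(y ± e_ν) − C^ξ(y)| ≤ 900·ξ·((ξ·max(1,|y|_∞))²)⁻¹·e^{−ξ|y|_∞/2} (p39's `abs_pdiffZ_Cxi_three_le_sup`/`abs_pdiffAdjZ_Cxi_three_le_sup`);
* `abs_Cxi_mixedDiff_profile_sup` (ν ≠ ν′, steps c, c′ ∈ {±1}) / `abs_Cxi_pureDiff_profile_sup`: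
  |ΔΔC^ξ(y)| ≤ 61000·ξ²·((ξ·max(1,|y|_∞))³)⁻¹·e^{−ξ|y|_∞/2} (this seat's `B3CxiSecondDifferenceBound`).
At y = 0 every value of C^ξ entering lies in [0, 140ξ^{−1}].  Mathlib + the cited tree files only; theorems only, no new definitions,
no named facts; standard axioms.  Unit `lit-balaban-p20-g7` (Phase-2 proof seat p20, gen 7), HOME `run/shared/lean/pub/lit-balaban/`,
2026-08-21.
-/

open scoped BigOperators
open Real Set

namespace Literature.MathematicalPhysics.QuantumFieldTheory.Balaban1983to89.B3CxiAllSitesProfiles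

open B3Sect3VectorSelfEnergy B3CxiPropagator B3CxiUniformBound B3CxiDerivativeBound B3CxiSecondDifferenceBound B3CxiTadpole

noncomputable section

variable {ξ : ℝ}

/-! ## 1. Values -/

/-- kernel: |0|_∞ = 0. [folklore] -/
private theorem supNorm_zero : supNorm (0 : ZSite 3) = 0 := by
  unfold supNorm; simp

/-- kernel: for y ≠ 0, 1 ≤ |y|_∞ (as a real) and max(1,|y|_∞) = |y|_∞. [folklore] -/
private theorem one_le_supNorm {y : ZSite 3} (hy : y ≠ 0) : (1 : ℝ) ≤ (supNorm y : ℝ) := by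
  obtain ⟨μ₀, hμ₀⟩ := exists_supNorm_eq y (by norm_num : 0 < 3)
  have hmax : ∀ μ, (y μ).natAbs ≤ (y μ₀).natAbs := fun μ => hμ₀ ▸ le_supNorm y μ
  rw [hμ₀]; exact one_le_max y hy μ₀ hmax

/-- kernel: max(1,|y|_∞) = |y|_∞ for y ≠ 0. [folklore] -/
private theorem max_one_supNorm {y : ZSite 3} (hy : y ≠ 0) : max (1 : ℝ) (supNorm y : ℝ) = (supNorm y : ℝ) :=
  max_eq_right (one_le_supNorm hy)

/-- **0 ≤ C^ξ(y) ≤ 140·ξ^{−1} at all sites** (0 < ξ ≤ 1): at the origin the tadpole bound 3(π+1)/(4π)·ξ^{−1} ≤ ξ^{−1}, elsewhere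
140·e^{−ξ|y|_∞/2}/(ξ|y|_∞) ≤ 140·ξ^{−1}. [cite: Balaban1983Higgs3, (2.10) p.426] -/
theorem Cxi_le_all (hξ : 0 < ξ) (hξ1 : ξ ≤ 1) (y : ZSite 3) : Cxi 3 ξ y ≤ 140 * ξ⁻¹ := by
  have hξi : 0 < ξ⁻¹ := inv_pos.mpr hξ
  by_cases hy : y = 0
  · subst hy
    refine (Cxi_zero_le_three hξ).trans ?_
    have hπ : 3 * (Real.pi + 1) / (4 * Real.pi) ≤ 1 := by
      rw [div_le_one (by positivity)]; linarith [Real.pi_gt_three]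
    nlinarith
  · have h := Cxi_three_le_sup hξ hξ1 y hy
    have hN := one_le_supNorm hy
    have he : Real.exp (-(ξ * supNorm y / 2)) ≤ 1 := Real.exp_le_one_iff.mpr (by nlinarith [hξ.le])
    calc Cxi 3 ξ y ≤ 140 * Real.exp (-(ξ * supNorm y / 2)) / (ξ * supNorm y) := h
      _ ≤ 140 * 1 / (ξ * 1) := by gcongr
      _ = 140 * ξ⁻¹ := by ring

/-- **|C^ξ(y)| ≤ 140·(ξ·max(1,|y|_∞))^{−1}·e^{−ξ|y|_∞/2} at all sites** (0 < ξ ≤ 1). [cite: Balaban1983Higgs3, (2.10) p.426] -/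
theorem abs_Cxi_profile_sup (hξ : 0 < ξ) (hξ1 : ξ ≤ 1) (y : ZSite 3) :
    |Cxi 3 ξ y| ≤ 140 * ((ξ * max (1 : ℝ) (supNorm y : ℝ))⁻¹ * Real.exp (-(ξ * supNorm y / 2))) := by
  rw [abs_of_nonneg (Cxi_nonneg hξ y)]
  by_cases hy : y = 0
  · subst hy
    rw [supNorm_zero, Nat.cast_zero, max_eq_left (zero_le_one : (0 : ℝ) ≤ 1), mul_one, mul_zero, zero_div, neg_zero,
      Real.exp_zero, mul_one]
    exact Cxi_le_all hξ hξ1 0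
  · rw [max_one_supNorm hy]
    have h := Cxi_three_le_sup hξ hξ1 y hy
    rw [div_eq_mul_inv] at h
    linarith

/-! ## 2. First differences -/

/-- **Forward difference at all sites**: |C^ξ(y+e_ν) − C^ξ(y)| ≤ 900·ξ·((ξ·max(1,|y|_∞))²)⁻¹·e^{−ξ|y|_∞/2} (0 < ξ ≤ 1; off the origin
p39's `abs_pdiffZ_Cxi_three_le_sup` times ξ, at it both values lie in [0, 140ξ^{−1}]). [cite: Balaban1983Higgs3, (2.10) p.426] -/
theorem abs_Cxi_fwdDiff_profile_sup (hξ : 0 < ξ) (hξ1 : ξ ≤ 1) (y : ZSite 3) (ν : Fin 3) :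
    |Cxi 3 ξ (y + unitVec ν) - Cxi 3 ξ y| ≤
      900 * ξ * (((ξ * max (1 : ℝ) (supNorm y : ℝ)) ^ 2)⁻¹ * Real.exp (-(ξ * supNorm y / 2))) := by
  have hξ' := hξ.ne'
  by_cases hy : y = 0
  · subst hy
    rw [supNorm_zero, Nat.cast_zero, max_eq_left (zero_le_one : (0 : ℝ) ≤ 1), mul_one, mul_zero, zero_div, neg_zero,
      Real.exp_zero, mul_one]
    have ha := Cxi_le_all hξ hξ1 ((0 : ZSite 3) + unitVec ν)
    have hb := Cxi_le_all hξ hξ1 (0 : ZSite 3)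
    have ha0 := Cxi_nonneg hξ ((0 : ZSite 3) + unitVec ν)
    have hb0 := Cxi_nonneg hξ (0 : ZSite 3)
    have h1 : |Cxi 3 ξ (0 + unitVec ν) - Cxi 3 ξ 0| ≤ 140 * ξ⁻¹ := by
      rw [abs_le]; constructor <;> linarith
    refine h1.trans ?_
    rw [show 900 * ξ * (ξ ^ 2)⁻¹ = 900 * ξ⁻¹ by field_simp]
    gcongr; norm_num
  · have h := abs_pdiffZ_Cxi_three_le_sup hξ hξ1 y hy ν
    unfold pdiffZ at h
    rw [abs_mul, abs_of_pos (inv_pos.mpr hξ)] at h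
    rw [max_one_supNorm hy]
    have hN := one_le_supNorm hy
    have hN' : (supNorm y : ℝ) ≠ 0 := by linarith
    have e : 900 * ξ * (((ξ * (supNorm y : ℝ)) ^ 2)⁻¹ * Real.exp (-(ξ * supNorm y / 2))) =
        ξ * (900 * Real.exp (-(ξ * supNorm y / 2)) / (ξ * supNorm y) ^ 2) := by ring
    rw [e]
    calc |Cxi 3 ξ (y + unitVec ν) - Cxi 3 ξ y| = ξ * (ξ⁻¹ * |Cxi 3 ξ (y + unitVec ν) - Cxi 3 ξ y|) := by field_simp
      _ ≤ _ := mul_le_mul_of_nonneg_left h hξ.le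

/-- **Backward difference at all sites**: |C^ξ(y−e_ν) − C^ξ(y)| ≤ 900·ξ·((ξ·max(1,|y|_∞))²)⁻¹·e^{−ξ|y|_∞/2}. [cite: Balaban1983Higgs3, (2.10) p.426] -/
theorem abs_Cxi_bwdDiff_profile_sup (hξ : 0 < ξ) (hξ1 : ξ ≤ 1) (y : ZSite 3) (ν : Fin 3) :
    |Cxi 3 ξ (y - unitVec ν) - Cxi 3 ξ y| ≤
      900 * ξ * (((ξ * max (1 : ℝ) (supNorm y : ℝ)) ^ 2)⁻¹ * Real.exp (-(ξ * supNorm y / 2))) := by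
  have hξ' := hξ.ne'
  by_cases hy : y = 0
  · subst hy
    rw [supNorm_zero, Nat.cast_zero, max_eq_left (zero_le_one : (0 : ℝ) ≤ 1), mul_one, mul_zero, zero_div, neg_zero,
      Real.exp_zero, mul_one]
    have ha := Cxi_le_all hξ hξ1 ((0 : ZSite 3) - unitVec ν)
    have hb := Cxi_le_all hξ hξ1 (0 : ZSite 3)
    have ha0 := Cxi_nonneg hξ ((0 : ZSite 3) - unitVec ν)
    have hb0 := Cxi_nonneg hξ (0 : ZSite 3)
    have h1 : |Cxi 3 ξ (0 - unitVec ν) - Cxi 3 ξ 0| ≤ 140 * ξ⁻¹ := by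
      rw [abs_le]; constructor <;> linarith
    refine h1.trans ?_
    rw [show 900 * ξ * (ξ ^ 2)⁻¹ = 900 * ξ⁻¹ by field_simp]
    gcongr; norm_num
  · have h := abs_pdiffAdjZ_Cxi_three_le_sup hξ hξ1 y hy ν
    unfold pdiffAdjZ at h
    rw [abs_mul, abs_of_pos (inv_pos.mpr hξ)] at h
    rw [max_one_supNorm hy]
    have hN := one_le_supNorm hy
    have hN' : (supNorm y : ℝ) ≠ 0 := by linarith
    have e : 900 * ξ * (((ξ * (supNorm y : ℝ)) ^ 2)⁻¹ * Real.exp (-(ξ * supNorm y / 2))) =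
        ξ * (900 * Real.exp (-(ξ * supNorm y / 2)) / (ξ * supNorm y) ^ 2) := by ring
    rw [e]
    calc |Cxi 3 ξ (y - unitVec ν) - Cxi 3 ξ y| = ξ * (ξ⁻¹ * |Cxi 3 ξ (y - unitVec ν) - Cxi 3 ξ y|) := by field_simp
      _ ≤ _ := mul_le_mul_of_nonneg_left h hξ.le

/-- kernel: coordinates of a shifted site. [folklore] -/
private theorem shift_apply {d : ℕ} (y : ZSite d) (ν μ : Fin d) (c : ℤ) :
    (y + c • unitVec ν) μ = y μ + if μ = ν then c else 0 := by
  by_cases h : μ = ν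
  · subst h; simp [unitVec]
  · simp [unitVec, h]

/-- kernel: y − e_ν = y + (−1)·e_ν. [folklore] -/
private theorem sub_unitVec_eq {d : ℕ} (y : ZSite d) (ν : Fin d) : y - unitVec ν = y + (-1 : ℤ) • unitVec ν := by
  funext μ
  rw [Pi.sub_apply, shift_apply]
  by_cases h : μ = ν
  · subst h; simp [unitVec]; omega
  · simp [unitVec, h]

/-- **Unit-step difference of either sign at all sites** (c ∈ {±1}): |C^ξ(y+ce_ν) − C^ξ(y)| ≤ 900·ξ·((ξ·max(1,|y|_∞))²)⁻¹·e^{−ξ|y|_∞/2}.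
[cite: Balaban1983Higgs3, (2.10) p.426] -/
theorem abs_Cxi_stepDiff_profile_sup (hξ : 0 < ξ) (hξ1 : ξ ≤ 1) (y : ZSite 3) (ν : Fin 3) {c : ℤ} (hc : c = 1 ∨ c = -1) :
    |Cxi 3 ξ (y + c • unitVec ν) - Cxi 3 ξ y| ≤
      900 * ξ * (((ξ * max (1 : ℝ) (supNorm y : ℝ)) ^ 2)⁻¹ * Real.exp (-(ξ * supNorm y / 2))) := by
  rcases hc with rfl | rfl
  · rw [one_smul]; exact abs_Cxi_fwdDiff_profile_sup hξ hξ1 y ν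
  · rw [← sub_unitVec_eq]; exact abs_Cxi_bwdDiff_profile_sup hξ hξ1 y ν

/-! ## 3. Second differences -/

/-- **Mixed second difference at all sites** (ν ≠ ν′, c, c′ ∈ {±1}):
|C^ξ(y+ce_ν+c′e_{ν′}) − C^ξ(y+ce_ν) − C^ξ(y+c′e_{ν′}) + C^ξ(y)| ≤ 61000·ξ²·((ξ·max(1,|y|_∞))³)⁻¹·e^{−ξ|y|_∞/2} (0 < ξ ≤ 1; off the origin
this seat's `abs_Cxi_mixedDiff_le_sup`, at it the four values lie in [0, 140ξ^{−1}]). [cite: Balaban1983Higgs3, (2.10) p.426] -/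
theorem abs_Cxi_mixedDiff_profile_sup (hξ : 0 < ξ) (hξ1 : ξ ≤ 1) (y : ZSite 3) {ν ν' : Fin 3} (hne : ν ≠ ν') {c c' : ℤ}
    (hc : c = 1 ∨ c = -1) (hc' : c' = 1 ∨ c' = -1) :
    |Cxi 3 ξ (y + c • unitVec ν + c' • unitVec ν') - Cxi 3 ξ (y + c • unitVec ν) - Cxi 3 ξ (y + c' • unitVec ν') + Cxi 3 ξ y| ≤
      61000 * ξ ^ 2 * (((ξ * max (1 : ℝ) (supNorm y : ℝ)) ^ 3)⁻¹ * Real.exp (-(ξ * supNorm y / 2))) := by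
  have hξ' := hξ.ne'
  by_cases hy : y = 0
  · subst hy
    rw [supNorm_zero, Nat.cast_zero, max_eq_left (zero_le_one : (0 : ℝ) ≤ 1), mul_one, mul_zero, zero_div, neg_zero,
      Real.exp_zero, mul_one]
    have h1 := Cxi_le_all hξ hξ1 ((0 : ZSite 3) + c • unitVec ν + c' • unitVec ν')
    have h2 := Cxi_le_all hξ hξ1 ((0 : ZSite 3) + c • unitVec ν)
    have h3 := Cxi_le_all hξ hξ1 ((0 : ZSite 3) + c' • unitVec ν')
    have h4 := Cxi_le_all hξ hξ1 (0 : ZSite 3)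
    have h10 := Cxi_nonneg hξ ((0 : ZSite 3) + c • unitVec ν + c' • unitVec ν')
    have h20 := Cxi_nonneg hξ ((0 : ZSite 3) + c • unitVec ν)
    have h30 := Cxi_nonneg hξ ((0 : ZSite 3) + c' • unitVec ν')
    have h40 := Cxi_nonneg hξ (0 : ZSite 3)
    have h : |Cxi 3 ξ (0 + c • unitVec ν + c' • unitVec ν') - Cxi 3 ξ (0 + c • unitVec ν) - Cxi 3 ξ (0 + c' • unitVec ν')
        + Cxi 3 ξ 0| ≤ 280 * ξ⁻¹ := by
      rw [abs_le]; constructor <;> linarith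
    refine h.trans ?_
    rw [show 61000 * ξ ^ 2 * (ξ ^ 3)⁻¹ = 61000 * ξ⁻¹ by field_simp]
    gcongr; norm_num
  · have h := abs_Cxi_mixedDiff_le_sup hξ hξ1 y hy hne hc hc'
    rw [max_one_supNorm hy]
    have hN := one_le_supNorm hy
    have hN' : (supNorm y : ℝ) ≠ 0 := by linarith
    refine h.trans (le_of_eq ?_)
    field_simp

/-- **Pure (centred) second difference at all sites**: |C^ξ(y+e_ν) − 2C^ξ(y) + C^ξ(y−e_ν)| ≤ 61000·ξ²·((ξ·max(1,|y|_∞))³)⁻¹·e^{−ξ|y|_∞/2}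
(0 < ξ ≤ 1). [cite: Balaban1983Higgs3, (2.10) p.426] -/
theorem abs_Cxi_pureDiff_profile_sup (hξ : 0 < ξ) (hξ1 : ξ ≤ 1) (y : ZSite 3) (ν : Fin 3) :
    |Cxi 3 ξ (y + unitVec ν) - 2 * Cxi 3 ξ y + Cxi 3 ξ (y - unitVec ν)| ≤
      61000 * ξ ^ 2 * (((ξ * max (1 : ℝ) (supNorm y : ℝ)) ^ 3)⁻¹ * Real.exp (-(ξ * supNorm y / 2))) := by
  have hξ' := hξ.ne'
  by_cases hy : y = 0
  · subst hy
    rw [supNorm_zero, Nat.cast_zero, max_eq_left (zero_le_one : (0 : ℝ) ≤ 1), mul_one, mul_zero, zero_div, neg_zero,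
      Real.exp_zero, mul_one]
    have h1 := Cxi_le_all hξ hξ1 ((0 : ZSite 3) + unitVec ν)
    have h2 := Cxi_le_all hξ hξ1 (0 : ZSite 3)
    have h3 := Cxi_le_all hξ hξ1 ((0 : ZSite 3) - unitVec ν)
    have h10 := Cxi_nonneg hξ ((0 : ZSite 3) + unitVec ν)
    have h20 := Cxi_nonneg hξ (0 : ZSite 3)
    have h30 := Cxi_nonneg hξ ((0 : ZSite 3) - unitVec ν)
    have h : |Cxi 3 ξ (0 + unitVec ν) - 2 * Cxi 3 ξ 0 + Cxi 3 ξ (0 - unitVec ν)| ≤ 280 * ξ⁻¹ := by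
      rw [abs_le]; constructor <;> linarith
    refine h.trans ?_
    rw [show 61000 * ξ ^ 2 * (ξ ^ 3)⁻¹ = 61000 * ξ⁻¹ by field_simp]
    gcongr; norm_num
  · have h := abs_Cxi_pureDiff_le_sup hξ hξ1 y hy ν
    rw [max_one_supNorm hy]
    have hN := one_le_supNorm hy
    have hN' : (supNorm y : ℝ) ≠ 0 := by linarith
    refine h.trans (le_of_eq ?_)
    field_simp

end

end Literature.MathematicalPhysics.QuantumFieldTheory.Balaban1983to89.B3CxiAllSitesProfiles
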